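import Summits.QuantumFields.BalabanUV.T4Continuum.Support.NE7EtaBackgroundEmbedding
import Summits.QuantumFields.BalabanUV.T4Continuum.Support.TermwiseAnalyticMarginLayered
import HarnessLib

/-!
# NE7EtaBackgroundFunctionalSocket — route #1 of the NE7 crux, stub S7 (NODE O): T.2 (`TermwiseAnalyticMarginLayered.lipBackground_of_layeredMargin`)
# DOCKED on the background-coordinate carrier `bgCarriers` ∕ `occCarriers` with `E := Amb n L N`, `ι := iota …`, `hgauge := hgauge_bgCarriers` —
# the socket `LipBackground` of node U3 ∕ `uRateUpTo_of_nodes` now costs EXACTLY T.2's eleven FUNCTIONAL-side data on the occurring backgrounds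

Cell `pub-balaban`, rung (B)+1 sub-cell t4, lineage `b2b-balaban-t4-ne7-p1`, generation 27 (CRUX PROVER NE7 #1, ruling e34b3e0c); crux
skeleton `t4/skeletons/NE7-CRUX-R1.md` v1.7.8 §0bis items 7 ∕ 10 (ii), §5 (G5) item (4).  HONEST FRAMING (page 1): FIXED FINITE T⁴, rung (B)+1;
NE7, NE3 NOT PRINTED in [Balaban1984PropagatorsI]–[Balaban1989LargeFieldII] and NOT PROVED here; continuum YM on T⁴ ⇐ BetaPertH ∧ nine spine
estimates (0/9 proved); BetaPertH ⇐ (D1) ∧ (D4) ∧ CAP+tail; G-an2-4 gates asym, D1 and NE2/3/4; NOT infinite volume, NOT mass gap, NOT Clay.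

WHY THIS FILE.  Route 1 consumes the Lipschitz-in-the-background bracket of the term data through T.2, whose CARRIER-side data (one complex normed
space `E`, an embedding `ι : C.BgA → E`, the domination `hgauge`) were inhabited on the carrier by `NE7EtaBackgroundEmbedding` (p258819:
`Amb n L N = lp (Slot n L N ·) ∞`, `iota`, `hgauge_bgCarriers` ∕ `hgauge_occCarriers`).  The crux refuter's probe F34 (PRICING-NE7 v10 §53,
`probe/K1_T2_junction.lean`) found that the APPLICATION of T.2 at these data elaborates only above the default instance-synthesis budget
(«failed to synthesize PseudoMetricSpace (Amb n L N)» at the `hcreate`∕`hdisp` binders; rc 0 from `synthInstance.maxHeartbeats 50000` on) —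
junction hygiene for the future consumer of (G5)(4).  THIS FILE performs that application ONCE, in the tree, so that NODE O's FUNCTIONAL half
(ownerless, XL) reads ONE theorem whose hypotheses are T.2's functional-side binders LITERALLY, on the carrier of record:

* **`lipBackground_bgCarriers_of_layeredMargin`** — for ANY admissible classes `admA`∕`admB` (carrier `bgCarriers`): T.2's eleven functional-side
  data `Dch`, `Φ`, `N`, `ϱ₀`, `Ec` with `hβ0 hβ hϱ₀ hcreate hD hdisp hT hhol0 hΦhol hbd0 hreal` (VERBATIM T.2's, at `E := Amb n L N`,
  `ι := iota …`, `C.scale X := sc X`, `C.d X := dl X`) ⇒ `LipBackground EA W κ (fun g j => 8·E₀ ∕ ϱ₀ g j)`; `hgauge` DISCHARGED by name.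
* **`lipBackground_occCarriers_of_layeredMargin`** — the same on the carrier of the OCCURRING classes `occCarriers n L N ε dom …` (trivial
  background, the `sfClass`-minimisers for data of `dom`, transports), the carrier on which gens 25–27 produced the `hclose` binder
  (`NE7EtaBackgroundRefineDischarge.hclose_of_regularSup`, p266066).
* **`lipBackground_occCarriers_of_layeredMargin_two`** — the constant spelled `4·(2E₀) ∕ ϱ₀` = LITERALLY the `CU` of
  `T4TowerRateDischarge.polyLipGrowth_of_couplingMargin` at `E₀ := 2E₀` (T.2's `_two` twin), so node T's `PolyLipGrowth` producer and
  `NE7EtaBackgroundTowerRate.uRateUpTo_bgCarriers_of_covRoot`'s binders `hU`∕`hG` compose BY NAME.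
CONSEQUENCE FOR THE BILL (G5)(4): what NODE O's functional half must inhabit is now ONE displayed list on the carrier of record — the complexified
chain `Ec g X k : Amb n L N → ℂ` of Bałaban's effective actions after `k` later steps (`Ec g X (k+1) = Ec g X k ∘ Φ g X k`), the substitutions `Φ`,
the pulled-back domains `Dch` (`Dch g X (k+1) = Φ g X k ⁻¹' Dch g X k`), the creation radius `ϱ₀` with the CREATION MARGIN `hcreate` around the
embedded OCCURRING backgrounds `iota U` (located constraint (F4) of p258129: not all configurations), the layered displacement `hdisp`
((S1-disp), [Balaban1988Convergent] (2.34)–(2.39) shape), holomorphy `hhol0`∕`hΦhol`, the creation bound `hbd0` (`E₀e^{−κ·dl X}`) and the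
real-value read-out `hreal` at step `N g X` — Bałaban's `E^{(j)}` AS TERMS ([dict], XL, ownerless).  Nothing of it is supplied here.
HONEST: one application of a landed theorem with its carrier-side binder discharged by a landed theorem; 0 def; 0 sorry; no estimate; nothing of
Bałaban's instantiated; the instance-synthesis budget is raised for the three docking theorems only (`synthInstance.maxHeartbeats 80000`, the
refuter's F34 reading: the `PseudoMetricSpace` projection of `lp`'s normed group over the scoped L²-operator matrix norms is expensive, not
ill-typed); NE3∕NE7 NOT proved; route 1 KERNEL-COMPLETE AT FORM LEVEL, DEPENDENT.
-/

set_option autoImplicit false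

noncomputable section

open Metric
open scoped BigOperators Matrix Matrix.Norms.L2Operator ENNReal

namespace Summit.QuantumFields.BalabanUV.T4Continuum.NE7EtaBackgroundFunctionalSocket

open Literature.MathematicalPhysics.QuantumFieldTheory.Balaban1983to89
open B7Prop1Explicit B7Prop2Explicit
open T4AveragingDeficitWall hiding Site Plane Plaq Bond
open T4OutputRate (Carriers Functional LipBackground)
open B14Radii (shrink)
open TermwiseAnalyticMarginLayered (lipBackground_of_layeredMargin lipBackground_of_layeredMargin_two)
open NE7EtaBackgroundCarrier NE7EtaBackgroundEmbedding

variable {n : Type} [Fintype n] [DecidableEq n] [Nonempty n]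

set_option synthInstance.maxHeartbeats 80000 in
/-- **T.2 DOCKED ON `bgCarriers`** (any admissible classes): the eleven functional-side data of
`TermwiseAnalyticMarginLayered.lipBackground_of_layeredMargin`, VERBATIM at `E := Amb n L N`, `ι := iota …` (`C.scale = sc`, `C.d = dl`,
`C.Dom = D`), give `LipBackground EA W κ (8·E₀ ∕ ϱ₀)`; the carrier-side binder `hgauge` is `NE7EtaBackgroundEmbedding.hgauge_bgCarriers`
(p258819).  One application; instance budget raised per the refuter's F34. [folklore] -/
theorem lipBackground_bgCarriers_of_layeredMargin (L N : ℕ) (D : Type) (sc : D → ℕ) (dl : D → ℝ) (hdl : ∀ X, 0 ≤ dl X)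
    (admA admB : ℕ → Set (Site 4 → Fin 4 → (Matrix n n ℂ)ˣ))
    (hmaps : ∀ (k : ℕ) (U : Site 4 → Fin 4 → (Matrix n n ℂ)ˣ), U ∈ admB k → rescale L (bavg L U) ∈ admA k)
    {EA : Functional (bgCarriers n L N D sc dl hdl admA admB hmaps) (bgCarriers n L N D sc dl hdl admA admB hmaps).BgA}
    {W : Set (ℕ → ℝ)} {κ E₀ β : ℝ}
    (Dch : (ℕ → ℝ) → D → ℕ → Set (Amb n L N)) (Φ : (ℕ → ℝ) → D → ℕ → Amb n L N → Amb n L N)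
    (Nst : (ℕ → ℝ) → D → ℕ) (ϱ₀ : (ℕ → ℝ) → ℕ → ℝ) (Ec : (ℕ → ℝ) → D → ℕ → Amb n L N → ℂ)
    (hβ0 : 0 ≤ β) (hβ : β ≤ 1 / 2) (hϱ₀ : ∀ g ∈ W, ∀ j, 0 < ϱ₀ g j)
    (hcreate : ∀ g ∈ W, ∀ (X : D) (U : (bgCarriers n L N D sc dl hdl admA admB hmaps).BgA),
      closedBall (iota L N D sc dl hdl admA admB hmaps U) (ϱ₀ g (sc X)) ⊆ Dch g X 0)
    (hD : ∀ g ∈ W, ∀ (X : D) (k : ℕ), Dch g X (k + 1) = Φ g X k ⁻¹' Dch g X k)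
    (hdisp : ∀ g ∈ W, ∀ (X : D) (k : ℕ) (z : Amb n L N),
      closedBall z ((shrink β k - shrink β (k + 1)) * ϱ₀ g (sc X)) ⊆ Dch g X k →
        dist (Φ g X k z) z ≤ (shrink β k - shrink β (k + 1)) * ϱ₀ g (sc X))
    (hT : ∀ g ∈ W, ∀ (X : D) (k : ℕ), Ec g X (k + 1) = Ec g X k ∘ Φ g X k)
    (hhol0 : ∀ g ∈ W, ∀ X : D, DifferentiableOn ℂ (Ec g X 0) (Dch g X 0))
    (hΦhol : ∀ g ∈ W, ∀ (X : D) (k : ℕ), DifferentiableOn ℂ (Φ g X k) (Dch g X (k + 1)))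
    (hbd0 : ∀ g ∈ W, ∀ X : D, ∀ z ∈ Dch g X 0, ‖Ec g X 0 z‖ ≤ E₀ * Real.exp (-(κ * dl X)))
    (hreal : ∀ g ∈ W, ∀ (X : D) (U : (bgCarriers n L N D sc dl hdl admA admB hmaps).BgA),
      Ec g X (Nst g X) (iota L N D sc dl hdl admA admB hmaps U) = (EA g U X : ℂ)) :
    LipBackground EA W κ (fun g j => 8 * E₀ / ϱ₀ g j) :=
  lipBackground_of_layeredMargin (C := bgCarriers n L N D sc dl hdl admA admB hmaps) (E := Amb n L N)
    (iota L N D sc dl hdl admA admB hmaps) Dch Φ Nst ϱ₀ Ec hβ0 hβ hϱ₀ hcreate hD hdisp hT hhol0 hΦhol hbd0 hreal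
    (hgauge_bgCarriers L N D sc dl hdl admA admB hmaps)

set_option synthInstance.maxHeartbeats 80000 in
/-- **T.2 DOCKED ON THE CARRIER OF THE OCCURRING CLASSES `occCarriers`** (trivial background, `sfClass`-minimisers for data of `dom`, transports —
the carrier of `NE7EtaBackgroundRefineDischarge.hclose_of_regularSup`): the eleven functional-side data of T.2, VERBATIM at `E := Amb n L N`,
`ι := iota … (occA …) (occB …) (rescale_bavg_mem_occA …)`, give `LipBackground EA W κ (8·E₀ ∕ ϱ₀)`; `hgauge` is `hgauge_occCarriers`.
[folklore] -/
theorem lipBackground_occCarriers_of_layeredMargin (L N : ℕ) (ε : ℝ) (dom : Set (Site 4 → Fin 4 → (Matrix n n ℂ)ˣ)) (D : Type)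
    (sc : D → ℕ) (dl : D → ℝ) (hdl : ∀ X, 0 ≤ dl X)
    {EA : Functional (occCarriers n L N ε dom D sc dl hdl) (occCarriers n L N ε dom D sc dl hdl).BgA}
    {W : Set (ℕ → ℝ)} {κ E₀ β : ℝ}
    (Dch : (ℕ → ℝ) → D → ℕ → Set (Amb n L N)) (Φ : (ℕ → ℝ) → D → ℕ → Amb n L N → Amb n L N)
    (Nst : (ℕ → ℝ) → D → ℕ) (ϱ₀ : (ℕ → ℝ) → ℕ → ℝ) (Ec : (ℕ → ℝ) → D → ℕ → Amb n L N → ℂ)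
    (hβ0 : 0 ≤ β) (hβ : β ≤ 1 / 2) (hϱ₀ : ∀ g ∈ W, ∀ j, 0 < ϱ₀ g j)
    (hcreate : ∀ g ∈ W, ∀ (X : D) (U : (occCarriers n L N ε dom D sc dl hdl).BgA),
      closedBall (iota L N D sc dl hdl (occA L N ε dom) (occB L N ε dom) (rescale_bavg_mem_occA L N ε dom) U) (ϱ₀ g (sc X))
        ⊆ Dch g X 0)
    (hD : ∀ g ∈ W, ∀ (X : D) (k : ℕ), Dch g X (k + 1) = Φ g X k ⁻¹' Dch g X k)
    (hdisp : ∀ g ∈ W, ∀ (X : D) (k : ℕ) (z : Amb n L N),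
      closedBall z ((shrink β k - shrink β (k + 1)) * ϱ₀ g (sc X)) ⊆ Dch g X k →
        dist (Φ g X k z) z ≤ (shrink β k - shrink β (k + 1)) * ϱ₀ g (sc X))
    (hT : ∀ g ∈ W, ∀ (X : D) (k : ℕ), Ec g X (k + 1) = Ec g X k ∘ Φ g X k)
    (hhol0 : ∀ g ∈ W, ∀ X : D, DifferentiableOn ℂ (Ec g X 0) (Dch g X 0))
    (hΦhol : ∀ g ∈ W, ∀ (X : D) (k : ℕ), DifferentiableOn ℂ (Φ g X k) (Dch g X (k + 1)))
    (hbd0 : ∀ g ∈ W, ∀ X : D, ∀ z ∈ Dch g X 0, ‖Ec g X 0 z‖ ≤ E₀ * Real.exp (-(κ * dl X)))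
    (hreal : ∀ g ∈ W, ∀ (X : D) (U : (occCarriers n L N ε dom D sc dl hdl).BgA),
      Ec g X (Nst g X) (iota L N D sc dl hdl (occA L N ε dom) (occB L N ε dom) (rescale_bavg_mem_occA L N ε dom) U) = (EA g U X : ℂ)) :
    LipBackground EA W κ (fun g j => 8 * E₀ / ϱ₀ g j) :=
  lipBackground_bgCarriers_of_layeredMargin L N D sc dl hdl (occA L N ε dom) (occB L N ε dom) (rescale_bavg_mem_occA L N ε dom)
    Dch Φ Nst ϱ₀ Ec hβ0 hβ hϱ₀ hcreate hD hdisp hT hhol0 hΦhol hbd0 hreal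

set_option synthInstance.maxHeartbeats 80000 in
/-- The same with the constant spelled `4·(2E₀) ∕ ϱ₀` — LITERALLY the `CU` of `T4TowerRateDischarge.polyLipGrowth_of_couplingMargin` at
`E₀ := 2E₀`, so `NE7EtaBackgroundTowerRate.uRateUpTo_bgCarriers_of_covRoot`'s binders `hU` (this) and `hG` (node T's producer) compose BY NAME
on `occCarriers`. [folklore] -/
theorem lipBackground_occCarriers_of_layeredMargin_two (L N : ℕ) (ε : ℝ) (dom : Set (Site 4 → Fin 4 → (Matrix n n ℂ)ˣ)) (D : Type)
    (sc : D → ℕ) (dl : D → ℝ) (hdl : ∀ X, 0 ≤ dl X)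
    {EA : Functional (occCarriers n L N ε dom D sc dl hdl) (occCarriers n L N ε dom D sc dl hdl).BgA}
    {W : Set (ℕ → ℝ)} {κ E₀ β : ℝ}
    (Dch : (ℕ → ℝ) → D → ℕ → Set (Amb n L N)) (Φ : (ℕ → ℝ) → D → ℕ → Amb n L N → Amb n L N)
    (Nst : (ℕ → ℝ) → D → ℕ) (ϱ₀ : (ℕ → ℝ) → ℕ → ℝ) (Ec : (ℕ → ℝ) → D → ℕ → Amb n L N → ℂ)
    (hβ0 : 0 ≤ β) (hβ : β ≤ 1 / 2) (hϱ₀ : ∀ g ∈ W, ∀ j, 0 < ϱ₀ g j)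
    (hcreate : ∀ g ∈ W, ∀ (X : D) (U : (occCarriers n L N ε dom D sc dl hdl).BgA),
      closedBall (iota L N D sc dl hdl (occA L N ε dom) (occB L N ε dom) (rescale_bavg_mem_occA L N ε dom) U) (ϱ₀ g (sc X))
        ⊆ Dch g X 0)
    (hD : ∀ g ∈ W, ∀ (X : D) (k : ℕ), Dch g X (k + 1) = Φ g X k ⁻¹' Dch g X k)
    (hdisp : ∀ g ∈ W, ∀ (X : D) (k : ℕ) (z : Amb n L N),
      closedBall z ((shrink β k - shrink β (k + 1)) * ϱ₀ g (sc X)) ⊆ Dch g X k →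
        dist (Φ g X k z) z ≤ (shrink β k - shrink β (k + 1)) * ϱ₀ g (sc X))
    (hT : ∀ g ∈ W, ∀ (X : D) (k : ℕ), Ec g X (k + 1) = Ec g X k ∘ Φ g X k)
    (hhol0 : ∀ g ∈ W, ∀ X : D, DifferentiableOn ℂ (Ec g X 0) (Dch g X 0))
    (hΦhol : ∀ g ∈ W, ∀ (X : D) (k : ℕ), DifferentiableOn ℂ (Φ g X k) (Dch g X (k + 1)))
    (hbd0 : ∀ g ∈ W, ∀ X : D, ∀ z ∈ Dch g X 0, ‖Ec g X 0 z‖ ≤ E₀ * Real.exp (-(κ * dl X)))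
    (hreal : ∀ g ∈ W, ∀ (X : D) (U : (occCarriers n L N ε dom D sc dl hdl).BgA),
      Ec g X (Nst g X) (iota L N D sc dl hdl (occA L N ε dom) (occB L N ε dom) (rescale_bavg_mem_occA L N ε dom) U) = (EA g U X : ℂ)) :
    LipBackground EA W κ (fun g j => 4 * (2 * E₀) / ϱ₀ g j) :=
  lipBackground_of_layeredMargin_two (C := occCarriers n L N ε dom D sc dl hdl) (E := Amb n L N)
    (iota L N D sc dl hdl (occA L N ε dom) (occB L N ε dom) (rescale_bavg_mem_occA L N ε dom)) Dch Φ Nst ϱ₀ Ec hβ0 hβ hϱ₀ hcreate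
    hD hdisp hT hhol0 hΦhol hbd0 hreal (hgauge_occCarriers L N ε dom D sc dl hdl)

end Summit.QuantumFields.BalabanUV.T4Continuum.NE7EtaBackgroundFunctionalSocket

end
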